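import Summits.Ventures.PercRepro.C026CutVertexB3
import Summits.Ventures.PercRepro.C026PFunCorner
import Summits.Ventures.PercRepro.C026PFunCurveL2
import Summits.Ventures.PercRepro.C026PFunTwoLiveAdjacent
import Summits.Ventures.PercRepro.C026PFunTwoLiveLeaf

/-!
# `(E00)` across a cut vertex separating a live vertex from the probe and the other live vertex (p6, gen 21)

mine-3's block lemma (MINE3-GLUING §39 (d) (ii)) for the corner identity `(E00)` of THEOREM L2, on p5's
THEOREM B (B3) (`C026CutVertexB3`): let `v` be a cut vertex of the two-colouring `side`
(`IsGluing v v v side`) with the probe `c` and the live vertex `a` on side `true` and the live vertex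
`b` on side `false`; `G₁ = G.part side true ∋ a, c, v`, `G₂ = G.part side false ∋ v, b`.  Write
`u = #{v ~ b}(G₂)`, `t = #{v ≁ b}(G₂)`, `p = #{v ~ b, v ≁̄ b}(G₂)`, `Y = #{c ~ a}(G₁)` and
`P = {a ~ v, c ~̄ v, c ≁̄ a}(G₁)`.  Then

  `pFun_liveCells_eq_cut_b :  (P_G)(0,0; a, b, c) = u · (P_{G₁})(0,0; a, v, c) + 2·t·Y − 2·p·#P`

(`(P)(0,0) = 2·Δ_CF + n(D,·)`, B3 for the slack, and `n(D,·)` factors through the cut vertex), and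
since `p ≤ t`, `p ≤ u` (complementation on `G₂`) and `2·#P ≤ 2·Y + (P_{G₁})(0,0; a, v, c)`
(`two_mul_card_P_le`: `P` and `N = {a ~ v, c ≁̄ a, c ≁̄ v}` are disjoint subsets of `{a ~ v}`, whose
count is `n(D,·) + #{a ~ v, a ≁ c}`, and `n(D,·) ≤ Y`), the corner identity of the block `G₁` with live
vertices `a, v` gives the corner identity of `G`:

  `pFun_liveCells_nonneg_of_cut_b : (E00)(G₁; a, v, c) → (E00)(G; a, b, c)`

— the `(E00)` analogue of p5's Corollary B (i), which for the slack `Δ_CF` needs the extra inequality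
`#P ≤ Y` (mine-3's Theorem P (a)); the room of `(E00)` pays it.  By the symmetry `a ↔ b` of the live
cells (`liveCells_comm`, `threeCells_comm`) the same holds with the live vertex `a` behind the cut
vertex.  COROLLARIES: THEOREM L2 at every band state (`pFun_threeCells_nonneg_of_cut_b`, `…_cut_a`), and
the unconditional classes «a live vertex behind a cut vertex adjacent to the other live vertex»
(`…_cut_b_edge`, via the adjacent-live-vertices theorem on the block) and «a live vertex behind a cut
vertex that is pendant in the block» (`…_cut_b_leaf`).
-/

namespace PercRepro

namespace MultiGraph

open Finset

variable {V E : Type*} {G : MultiGraph V E}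

section Symm

variable [DecidableEq V]

/-- The corner cells are symmetric in the two live vertices. -/
theorem liveCells_comm (a b : V) : liveCells a b = liveCells b a := by
  funext v
  simp only [liveCells, or_comm]

/-- The three-cell band state is symmetric in the two live vertices. -/
theorem threeCells_comm (c a b : V) (z x₁ x₂ : ℝ) :
    threeCells c a b z x₁ x₂ = threeCells c b a z x₂ x₁ := by
  funext v
  simp only [threeCells, mul_comm (if v = a then x₁ else 1)]

end Symm

section CutB

variable [Fintype E] {v : V} {side : E → Bool}

open Classical in
/-- `n(D,·) = #{c ~ a ∧ c ~ b}` factors across the cut vertex: `#{c ~ a ∧ c ~ v}(G₁) · #{v ~ b}(G₂)`. -/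
theorem card_D_cut_b (hg : G.IsGluing v v v side) {a b c : V}
    (ha : G.OnSide side true a) (hb : G.OnSide side false b) (hc : G.OnSide side true c)
    (hcb : c ≠ b) :
    (univ.filter fun ω : Config E => G.Conn ω c a ∧ G.Conn ω c b).card =
      (univ.filter fun ω₂ : Config {e // side e = false} => (G.part side false).Conn ω₂ v b).card *
        (univ.filter fun ω₁ : Config {e // side e = true} =>
          (G.part side true).Conn ω₁ c a ∧ (G.part side true).Conn ω₁ c v).card := by
  have htf : true ≠ false := by decide
  have hfilt : (univ.filter fun ω : Config E => G.Conn ω c a ∧ G.Conn ω c b) =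
      univ.filter fun ω : Config E =>
        ((G.part side true).Conn (sideRestrict ω side true) c a ∧
          (G.part side true).Conn (sideRestrict ω side true) c v) ∧
        (G.part side false).Conn (sideRestrict ω side false) v b := by
    refine filter_congr fun ω _ => ?_
    rw [conn_cut_iff_same hg htf (Or.inr hc) (Or.inr ha) ω,
      conn_cut_iff_cross hg htf (Or.inr hc) hb hcb ω]
    tauto
  rw [hfilt, mul_comm]
  convert card_filter_cut side
    (fun ω₁ => (G.part side true).Conn ω₁ c a ∧ (G.part side true).Conn ω₁ c v)
    (fun ω₂ => (G.part side false).Conn ω₂ v b) using 5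

variable [Fintype V] [DecidableEq V]

open Classical in
/-- **The corner value of `(P)` across a cut vertex separating `b` from `a, c`** (p5's B3 for the
slack, plus the factorisation of `n(D,·)`):
`(P_G)(0,0; a, b, c) = u · (P_{G₁})(0,0; a, v, c) + 2·t·Y − 2·p·#P`. -/
theorem pFun_liveCells_eq_cut_b (hg : G.IsGluing v v v side) {a b c : V}
    (ha : G.OnSide side true a) (hb : G.OnSide side false b) (hc : G.OnSide side true c)
    (hab : a ≠ b) (hcb : c ≠ b) :
    G.pFun c (liveCells a b) (liveCells a b) univ =
      ((univ.filter fun ω₂ : Config {e // side e = false} =>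
          (G.part side false).Conn ω₂ v b).card : ℝ) *
        (G.part side true).pFun c (liveCells a v) (liveCells a v) univ +
      2 * ((univ.filter fun ω₂ : Config {e // side e = false} =>
          ¬ (G.part side false).Conn ω₂ v b).card : ℝ) *
        ((univ.filter fun ω₁ : Config {e // side e = true} =>
          (G.part side true).Conn ω₁ c a).card : ℝ) -
      2 * ((univ.filter fun ω₂ : Config {e // side e = false} =>
          (G.part side false).Conn ω₂ v b ∧ ¬ (G.part side false).Conn ω₂ᶜ v b).card : ℝ) *
        ((univ.filter fun ω₁ : Config {e // side e = true} =>
          (G.part side true).Conn ω₁ a v ∧ (G.part side true).Conn ω₁ᶜ c v ∧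
            ¬ (G.part side true).Conn ω₁ᶜ c a).card : ℝ) := by
  rw [pFun_liveCells_eq, pFun_liveCells_eq, slackCF_cut_b hg ha hb hc hab hcb,
    card_D_cut_b hg ha hb hc hcb]
  push_cast
  ring

end CutB

section Bookkeeping

variable [Fintype V] [DecidableEq V] [Fintype E]

omit [Fintype V] [DecidableEq V] in
open Classical in
/-- `p ≤ t` on the `b`-side: the configurations joining `v` to `b` in red but not in blue are, by
complementation, as many as those joining in blue but not in red, which do not join in red. -/
theorem card_conn_not_conn_compl_le {G₂ : MultiGraph V E} (v b : V) :
    (univ.filter fun ω : Config E => G₂.Conn ω v b ∧ ¬ G₂.Conn ωᶜ v b).card ≤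
      (univ.filter fun ω : Config E => ¬ G₂.Conn ω v b).card := by
  have h : (univ.filter fun ω : Config E => G₂.Conn ω v b ∧ ¬ G₂.Conn ωᶜ v b).card =
      (univ.filter fun ω : Config E => G₂.Conn ωᶜ v b ∧ ¬ G₂.Conn ω v b).card :=
    card_filter_compl_eq _ _ fun ω => by simp only [compl_compl]
  rw [h]
  refine card_le_card fun ω hω => ?_
  simp only [mem_filter, mem_univ, true_and] at hω ⊢
  exact hω.2

open Classical in
/-- **The bookkeeping inequality** on the block: `2·#P ≤ 2·Y + (P)(0,0; a, v, c)`, where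
`P = {a ~ v, c ~̄ v, c ≁̄ a}` and `Y = #{c ~ a}`. -/
theorem two_mul_card_P_le {G₁ : MultiGraph V E} (a v c : V) :
    2 * ((univ.filter fun ω : Config E =>
        G₁.Conn ω a v ∧ G₁.Conn ωᶜ c v ∧ ¬ G₁.Conn ωᶜ c a).card : ℝ) ≤
      2 * ((univ.filter fun ω : Config E => G₁.Conn ω c a).card : ℝ) +
        G₁.pFun c (liveCells a v) (liveCells a v) univ := by
  rw [pFun_liveCells_eq]
  -- the slack in this file's instances (p5's `slackCF` carries its own classical ones)
  have hslack : (G₁.slackCF a v c : ℝ) =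
      ((univ.filter fun ω : Config E => G₁.Conn ω a v ∧ ¬ G₁.Conn ω a c).card : ℝ) +
        ((univ.filter fun ω : Config E => G₁.Conn ω c a ∧ ¬ G₁.Conn ω c v).card : ℝ) +
        ((univ.filter fun ω : Config E => G₁.Conn ω c v ∧ ¬ G₁.Conn ω c a).card : ℝ) -
        ((univ.filter fun ω : Config E =>
          G₁.Conn ω a v ∧ ¬ G₁.Conn ωᶜ c a ∧ ¬ G₁.Conn ωᶜ c v).card : ℝ) := by
    unfold slackCF
    push_cast
    congr!
  rw [hslack]
  -- `P` and `N` are disjoint subsets of `{a ~ v}`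
  have hPN : (univ.filter fun ω : Config E =>
        G₁.Conn ω a v ∧ G₁.Conn ωᶜ c v ∧ ¬ G₁.Conn ωᶜ c a).card +
      (univ.filter fun ω : Config E =>
        G₁.Conn ω a v ∧ ¬ G₁.Conn ωᶜ c a ∧ ¬ G₁.Conn ωᶜ c v).card ≤
      (univ.filter fun ω : Config E => G₁.Conn ω a v).card := by
    rw [← card_union_of_disjoint]
    · exact card_le_card fun ω hω => by
        simp only [mem_union, mem_filter, mem_univ, true_and] at hω ⊢
        rcases hω with h | h <;> exact h.1
    · rw [disjoint_filter]
      intro ω _ h1 h2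
      exact h2.2.2 h1.2.1
  -- `#{a ~ v} = n(D,·) + #{a ~ v, a ≁ c}`
  have hsplit : (univ.filter fun ω : Config E => G₁.Conn ω a v).card =
      (univ.filter fun ω : Config E => G₁.Conn ω c a ∧ G₁.Conn ω c v).card +
        (univ.filter fun ω : Config E => G₁.Conn ω a v ∧ ¬ G₁.Conn ω a c).card := by
    rw [← card_filter_add_card_filter_not (s := univ.filter fun ω : Config E => G₁.Conn ω a v)
      (fun ω => G₁.Conn ω c a), filter_filter, filter_filter]
    congr 1
    · refine congrArg card (filter_congr ?_)
      intro ω _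
      constructor
      · rintro ⟨h1, h2⟩
        exact ⟨h2, h2.trans h1⟩
      · rintro ⟨h1, h2⟩
        exact ⟨h1.symm.trans h2, h1⟩
    · refine congrArg card (filter_congr ?_)
      intro ω _
      rw [conn_comm (u := a) (v := c)]
  -- `n(D,·) ≤ Y`
  have hDY : (univ.filter fun ω : Config E => G₁.Conn ω c a ∧ G₁.Conn ω c v).card ≤
      (univ.filter fun ω : Config E => G₁.Conn ω c a).card := by
    refine card_le_card fun ω hω => ?_
    simp only [mem_filter, mem_univ, true_and] at hω ⊢
    exact hω.1
  have hB1 : (0 : ℝ) ≤ ((univ.filter fun ω : Config E => G₁.Conn ω c a ∧ ¬ G₁.Conn ω c v).card : ℝ) :=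
    Nat.cast_nonneg _
  have hB2 : (0 : ℝ) ≤ ((univ.filter fun ω : Config E => G₁.Conn ω c v ∧ ¬ G₁.Conn ω c a).card : ℝ) :=
    Nat.cast_nonneg _
  have hPN' := (Nat.cast_le (α := ℝ)).2 hPN
  have hsplit' := congrArg (Nat.cast (R := ℝ)) hsplit
  have hDY' := (Nat.cast_le (α := ℝ)).2 hDY
  push_cast at hPN' hsplit' hDY'
  linarith

end Bookkeeping

section Transfer

variable [Fintype V] [DecidableEq V] [Fintype E] {v : V} {side : E → Bool}

open Classical in
/-- **`(E00)` transfers across a cut vertex separating `b` from `a, c`** (mine-3's block lemma (ii)):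
the corner identity of the block `G₁ = G.part side true` with live vertices `a, v` gives the corner
identity of `G` with live vertices `a, b`. -/
theorem pFun_liveCells_nonneg_of_cut_b (hg : G.IsGluing v v v side) {a b c : V}
    (ha : G.OnSide side true a) (hb : G.OnSide side false b) (hc : G.OnSide side true c)
    (hab : a ≠ b) (hcb : c ≠ b)
    (hv : 0 ≤ (G.part side true).pFun c (liveCells a v) (liveCells a v) univ) :
    0 ≤ G.pFun c (liveCells a b) (liveCells a b) univ := by
  rw [pFun_liveCells_eq_cut_b hg ha hb hc hab hcb]
  have hpt : ((univ.filter fun ω₂ : Config {e // side e = false} =>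
        (G.part side false).Conn ω₂ v b ∧ ¬ (G.part side false).Conn ω₂ᶜ v b).card : ℝ) ≤
      ((univ.filter fun ω₂ : Config {e // side e = false} =>
        ¬ (G.part side false).Conn ω₂ v b).card : ℝ) := by
    have h := (Nat.cast_le (α := ℝ)).2 (card_conn_not_conn_compl_le (G₂ := G.part side false) v b)
    convert h using 2 <;> congr!
  have hpu : ((univ.filter fun ω₂ : Config {e // side e = false} =>
        (G.part side false).Conn ω₂ v b ∧ ¬ (G.part side false).Conn ω₂ᶜ v b).card : ℝ) ≤
      ((univ.filter fun ω₂ : Config {e // side e = false} =>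
        (G.part side false).Conn ω₂ v b).card : ℝ) :=
    (Nat.cast_le (α := ℝ)).2 (card_le_card fun ω₂ hω => by
      simp only [mem_filter, mem_univ, true_and] at hω ⊢
      exact hω.1)
  have hI2 : 2 * ((univ.filter fun ω₁ : Config {e // side e = true} =>
        (G.part side true).Conn ω₁ a v ∧ (G.part side true).Conn ω₁ᶜ c v ∧
          ¬ (G.part side true).Conn ω₁ᶜ c a).card : ℝ) ≤
      2 * ((univ.filter fun ω₁ : Config {e // side e = true} =>
        (G.part side true).Conn ω₁ c a).card : ℝ) +
        (G.part side true).pFun c (liveCells a v) (liveCells a v) univ := by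
    have h := two_mul_card_P_le (G₁ := G.part side true) a v c
    convert h using 2 <;> congr!
  have hY : (0 : ℝ) ≤ ((univ.filter fun ω₁ : Config {e // side e = true} =>
    (G.part side true).Conn ω₁ c a).card : ℝ) := Nat.cast_nonneg _
  have hp : (0 : ℝ) ≤ ((univ.filter fun ω₂ : Config {e // side e = false} =>
    (G.part side false).Conn ω₂ v b ∧ ¬ (G.part side false).Conn ω₂ᶜ v b).card : ℝ) :=
    Nat.cast_nonneg _
  nlinarith [mul_nonneg hp (sub_nonneg.2 hI2), mul_nonneg (sub_nonneg.2 hpu) hv,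
    mul_nonneg (sub_nonneg.2 hpt) hY]

open Classical in
/-- The same with the live vertex `a` behind the cut vertex (by the symmetry of the live cells). -/
theorem pFun_liveCells_nonneg_of_cut_a (hg : G.IsGluing v v v side) {a b c : V}
    (ha : G.OnSide side false a) (hb : G.OnSide side true b) (hc : G.OnSide side true c)
    (hab : a ≠ b) (hca : c ≠ a)
    (hv : 0 ≤ (G.part side true).pFun c (liveCells b v) (liveCells b v) univ) :
    0 ≤ G.pFun c (liveCells a b) (liveCells a b) univ := by
  rw [liveCells_comm]
  exact pFun_liveCells_nonneg_of_cut_b hg hb ha hc hab.symm hca hv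

open Classical in
/-- THEOREM L2 transfers across a cut vertex separating `b` from `a, c`. -/
theorem pFun_threeCells_nonneg_of_cut_b (hg : G.IsGluing v v v side) {a b c : V}
    (ha : G.OnSide side true a) (hb : G.OnSide side false b) (hc : G.OnSide side true c)
    (hab : a ≠ b) (hcb : c ≠ b)
    (hv : 0 ≤ (G.part side true).pFun c (liveCells a v) (liveCells a v) univ)
    {z κ x₁ K₁ x₂ K₂ : ℝ} (hz : 0 ≤ z ∧ z ≤ 1) (hκ : kMin z ≤ κ) (hx₁ : 0 ≤ x₁ ∧ x₁ ≤ 1)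
    (hx₂ : 0 ≤ x₂ ∧ x₂ ≤ 1) (hK₁ : kMin x₁ ≤ K₁) (hK₂ : kMin x₂ ≤ K₂) :
    0 ≤ G.pFun c (threeCells c a b z x₁ x₂) (threeCells c a b κ K₁ K₂) univ :=
  pFun_threeCells_nonneg_of_E00 c a b hz hκ hx₁ hx₂ hK₁ hK₂
    (pFun_liveCells_nonneg_of_cut_b hg ha hb hc hab hcb hv)

open Classical in
/-- THEOREM L2 transfers across a cut vertex separating `a` from `b, c`. -/
theorem pFun_threeCells_nonneg_of_cut_a (hg : G.IsGluing v v v side) {a b c : V}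
    (ha : G.OnSide side false a) (hb : G.OnSide side true b) (hc : G.OnSide side true c)
    (hab : a ≠ b) (hca : c ≠ a)
    (hv : 0 ≤ (G.part side true).pFun c (liveCells b v) (liveCells b v) univ)
    {z κ x₁ K₁ x₂ K₂ : ℝ} (hz : 0 ≤ z ∧ z ≤ 1) (hκ : kMin z ≤ κ) (hx₁ : 0 ≤ x₁ ∧ x₁ ≤ 1)
    (hx₂ : 0 ≤ x₂ ∧ x₂ ≤ 1) (hK₁ : kMin x₁ ≤ K₁) (hK₂ : kMin x₂ ≤ K₂) :
    0 ≤ G.pFun c (threeCells c a b z x₁ x₂) (threeCells c a b κ K₁ K₂) univ := by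
  rw [threeCells_comm c a b z x₁ x₂, threeCells_comm c a b κ K₁ K₂]
  exact pFun_threeCells_nonneg_of_cut_b hg hb ha hc hab.symm hca hv hz hκ hx₂ hx₁ hK₂ hK₁

open Classical in
/-- THEOREM L2 on every skeleton with a live vertex `b` behind a cut vertex `v` joined to the other live
vertex `a` by an edge (the block has adjacent live vertices `a, v`). -/
theorem pFun_threeCells_nonneg_of_cut_b_edge (hg : G.IsGluing v v v side) {a b c : V}
    (ha : G.OnSide side true a) (hb : G.OnSide side false b) (hc : G.OnSide side true c)
    (hab : a ≠ b) (hcb : c ≠ b) (e : E)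
    (he : (G.fst e = a ∧ G.snd e = v) ∨ (G.fst e = v ∧ G.snd e = a))
    {z κ x₁ K₁ x₂ K₂ : ℝ} (hz : 0 ≤ z ∧ z ≤ 1) (hκ : kMin z ≤ κ) (hx₁ : 0 ≤ x₁ ∧ x₁ ≤ 1)
    (hx₂ : 0 ≤ x₂ ∧ x₂ ≤ 1) (hK₁ : kMin x₁ ≤ K₁) (hK₂ : kMin x₂ ≤ K₂) :
    0 ≤ G.pFun c (threeCells c a b z x₁ x₂) (threeCells c a b κ K₁ K₂) univ := by
  have hs : side e = true := by
    rcases he with ⟨h1, _⟩ | ⟨_, h2⟩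
    · exact ha e (Or.inl h1)
    · exact ha e (Or.inr h2)
  refine pFun_threeCells_nonneg_of_cut_b hg ha hb hc hab hcb ?_ hz hκ hx₁ hx₂ hK₁ hK₂
  refine pFun_liveCells_nonneg_of_edge_ab (G := G.part side true) a v c ⟨e, hs⟩ ?_
  simpa using he

open Classical in
/-- THEOREM L2 on every skeleton with a live vertex `b` behind a cut vertex `v` that carries a single
edge on the block side (the block has the pendant live vertex `v`). -/
theorem pFun_threeCells_nonneg_of_cut_b_leaf (hg : G.IsGluing v v v side) {a b c : V}
    (ha : G.OnSide side true a) (hb : G.OnSide side false b) (hc : G.OnSide side true c)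
    (hab : a ≠ b) (hcb : c ≠ b) (e : E) (hs : side e = true)
    (hleaf : ∀ f, side f = true → G.fst f = v ∨ G.snd f = v → f = e)
    {z κ x₁ K₁ x₂ K₂ : ℝ} (hz : 0 ≤ z ∧ z ≤ 1) (hκ : kMin z ≤ κ) (hx₁ : 0 ≤ x₁ ∧ x₁ ≤ 1)
    (hx₂ : 0 ≤ x₂ ∧ x₂ ≤ 1) (hK₁ : kMin x₁ ≤ K₁) (hK₂ : kMin x₂ ≤ K₂) :
    0 ≤ G.pFun c (threeCells c a b z x₁ x₂) (threeCells c a b κ K₁ K₂) univ := by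
  refine pFun_threeCells_nonneg_of_cut_b hg ha hb hc hab hcb ?_ hz hκ hx₁ hx₂ hK₁ hK₂
  refine pFun_liveCells_nonneg_of_leaf' a v c ⟨e, hs⟩ ?_
  rintro ⟨f, hf⟩ hfv
  exact Subtype.ext (hleaf f hf hfv)

end Transfer

end MultiGraph

end PercRepro
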